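import Summits.QuantumFields.YangMills.Theses.OnsetCalibration

/-!
# Route `OnsetCalibration` — K1 `OnsetFloors` is implied by the ladder's residual `BalabanLadder.NT` (bridge, proved)

`onsetFloors_of_NT : BalabanLadder.NT → OnsetCalibration.OnsetFloors`.  The route declares its floor crux K1
(stmt-QuantumFields-23314) to be "the NT residual in scale-free form"; this file kernel-checks that declaration in the
useful direction: the spine's non-triviality conjunct `NT` (for every compact simple `G`: a representation `r` and a
unit map `a → 0` with the k-free `LowerBounds G r a`) gives, for every SU(2)-class `G`, the scale-free floors of K1 —
take the two `LowerBounds` witnesses, `ε := min`, `Λ₅ := max`, `β₅ := max` of the thresholds and of a point past which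
`a β ≤ 1`, and the onset resolution `s := a β`.

HONEST LABEL: a CONDITIONAL bridge; `NT` is open (it is the ladder's non-triviality residual), so K1 stays open.
Nothing here bears on the mass gap; no summit is proved.
-/

set_option autoImplicit false

noncomputable section

open MeasureTheory Filter Topology
open Literature.MathematicalPhysics.QuantumFieldTheory Literature.MathematicalPhysics.QuantumLattice
open Summit.QuantumFields.YangMills.Cruxes.OSLegsFromFemtoAndGap.DlrCollarTransfer

namespace Summit.QuantumFields.YangMills.Theorems.OnsetCalibration

/-- **K1 from NT**: the ladder's residual non-triviality conjunct `BalabanLadder.NT` implies the route's floor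
crux `OnsetFloors` (the onset resolution at `β` is the unit `a β` of the `NT` witness). Conditional bridge only. -/
theorem onsetFloors_of_NT (hNT : Summit.QuantumFields.YangMills.Theses.BalabanLadder.NT) :
    Summit.QuantumFields.YangMills.Theses.OnsetCalibration.OnsetFloors := by
  unfold Summit.QuantumFields.YangMills.Theses.OnsetCalibration.OnsetFloors
  intro G _ _ _ _ hG _hcl
  letI : MeasurableSpace G := borel G
  haveI : BorelSpace G := ⟨rfl⟩
  obtain ⟨r, a, ha, ha0, ⟨v, ε₂, β₂, Λ₂, hv, hε₂, h2⟩, ⟨f, g, h, ε₃, β₃, Λ₃, hfg, hgh, hfh, hε₃, h3⟩⟩ := hNT G hG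
  -- past `β₁` the unit is at most `1`
  obtain ⟨β₁, hβ₁⟩ := Filter.eventually_atTop.1 ((tendsto_order.1 ha0).2 1 one_pos)
  refine ⟨r, v, f, g, h, min ε₂ ε₃, max Λ₂ Λ₃, max (max β₂ β₃) β₁, hv, hfg, hgh, hfh, lt_min hε₂ hε₃, ?_⟩
  intro β hβ
  have hβ₂ : β₂ ≤ β := le_trans (le_max_left _ _) (le_trans (le_max_left _ _) hβ)
  have hβ₃ : β₃ ≤ β := le_trans (le_max_right _ _) (le_trans (le_max_left _ _) hβ)
  have hβ₁' : β₁ ≤ β := le_trans (le_max_right _ _) hβ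
  refine ⟨a β, ha β, (hβ₁ β hβ₁').le, fun L hL => ?_, fun L hL => ?_⟩
  · exact (min_le_left _ _).trans (h2 β hβ₂ L ((le_max_left _ _).trans hL))
  · exact (min_le_right _ _).trans (h3 β hβ₃ L ((le_max_right _ _).trans hL))

end Summit.QuantumFields.YangMills.Theorems.OnsetCalibration

end
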